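import Summits.CriticalPhenomena.CardyFormulaZ2.Theorems.CardyComplexConeDefs
import Literature.Probability.Percolation.LatticeSymmetry
import Literature.Probability.Percolation.BondPercolationSymmetry
import Literature.Probability.Percolation.Crossings

/-!
# Stub `stub_halfArm_le_strip` of line `qkz-strip-boundary-arm`
(crux `EdgePrecompact`, stmt-CriticalPhenomena-11387)

Lattice-symmetry glue: for `L = 2m+1 ≤ n` and any site `b` of the diagonal level `2m`,
`halfArm n ≤ 2 · P_{1/2}(wallConn L b)`.

Write `lvl x = x₀ + x₁` for the diagonal level of a site of `ℤ²`; every lattice edge changes the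
level by `±1` (`level_of_adj`). Almost surely (`setBernoulli_ae_subset`) open edges are lattice
edges, and on that event:
1. Monotonicity / truncation (`exists_hit_level`): an open walk from `0` (level `0`) to a site of
   level `≥ n ≥ L` inside the half-plane `lvl ≥ 0` passes a FIRST site `z` of level exactly `L`;
   its prefix lies in the strip `0 ≤ lvl ≤ L`, so `halfArmEvent n ⊆ C(strip; {0}, {lvl = L})`.
2. Symmetry (`exists_levelFlip`): `Φ x = (L − x₁, −x₀)` is an automorphism of `ℤ²` with
   `lvl (Φ x) = L − lvl x`; it maps the strip onto itself, `{lvl = L}` onto the wall `{lvl = 0}`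
   and `0` to `a := Φ 0` (level `L`), so `P(C(strip; {0}, {lvl = L})) = P(wallConn L a)`
   (`bondPercolation_real_image`).
3. First step + union bound (`wallConn_first_step`): an open path from `a` (level `L ≥ 1`) to the
   wall inside the strip leaves `a` through a strip-neighbour `a − eᵢ` (level `L − 1 = 2m`), so
   `P(wallConn L a) ≤ Σᵢ P(wallConn L (a − eᵢ))`.
4. Translation along the level lines (`real_wallConn_of_level_eq`): sites of equal level have the
   same `P(wallConn L ·)` (`real_openCrossing_shift`), so each summand equals `P(wallConn L b)`.
-/

namespace Summit.CriticalPhenomena.CardyFormulaZ2.Cruxes.EdgePrecompact.QkzStripBoundaryArm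

open MeasureTheory Filter Set Metric
open scoped Topology BigOperators Pointwise
open Literature.Probability.LatticeModels Literature.Probability.Percolation
open Literature.Probability.RandomPlanarGeometry (DobrushinDomain)
open Summit.CriticalPhenomena.CardyFormulaZ2.Theses.CardyComplexCone

/-! ## Levels -/

/-- A unit vector of `ℤ²` has level `1`. -/
private theorem level_single (i : Fin 2) :
    (Pi.single i (1 : ℤ) : Site 2) 0 + (Pi.single i (1 : ℤ) : Site 2) 1 = 1 := by
  fin_cases i <;> simp

/-- A lattice edge of `ℤ²` changes the level `x₀ + x₁` by `±1`. -/
private theorem level_of_adj {x y : Site 2} (h : (zdGraph 2).Adj x y) :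
    y 0 + y 1 = x 0 + x 1 + 1 ∨ y 0 + y 1 + 1 = x 0 + x 1 := by
  obtain ⟨i, hi | hi⟩ := (zdGraph_adj_iff x y).1 h
  · left
    rw [hi]
    simp only [Pi.add_apply]
    have := level_single i
    omega
  · right
    rw [hi]
    simp only [Pi.add_apply]
    have := level_single i
    omega

/-- Open edges of a lattice configuration are lattice edges. -/
private theorem adj_of_openGraph_adj {ω : BondConfig (Site 2)} (hω : ω ⊆ (zdGraph 2).edgeSet)
    {x y : Site 2} (h : (openGraph ω).Adj x y) : (zdGraph 2).Adj x y :=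
  (SimpleGraph.mem_edgeSet (zdGraph 2)).1 (hω ((openGraph_adj ω x y).1 h).1)

/-! ## Walks -/

/-- `{x ↔ y in S}` yields an open walk from `x` to `y` with all vertices in `S`. -/
-- adapted from Literature.Probability.LatticeModels.IsoradialPercolationProofs
-- (`exists_reachable_induce_iff_exists_walk`)
private theorem exists_walk_of_openConnIn {ω : BondConfig (Site 2)} {S : Set (Site 2)}
    {x y : Site 2} (h : ω ∈ openConnIn S x y) :
    ∃ W : (openGraph ω).Walk x y, ∀ v ∈ W.support, v ∈ S := by
  obtain ⟨hx, hy, ⟨q⟩⟩ := h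
  refine ⟨(q.map (SimpleGraph.Embedding.induce S).toHom).copy rfl rfl, fun v hv => ?_⟩
  rw [SimpleGraph.Walk.support_copy, SimpleGraph.Walk.support_map] at hv
  obtain ⟨u, -, rfl⟩ := List.mem_map.1 hv
  exact u.2

/-- An open walk with all vertices in `S` witnesses `{x ↔ y in S}`. -/
private theorem openConnIn_of_walk {ω : BondConfig (Site 2)} {S : Set (Site 2)} {x y : Site 2}
    (W : (openGraph ω).Walk x y) (hW : ∀ v ∈ W.support, v ∈ S) : ω ∈ openConnIn S x y :=
  ⟨hW x W.start_mem_support, hW y W.end_mem_support, ⟨W.induce S hW⟩⟩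

/-- Truncation at the first passage of level `L`: an open lattice walk inside the half-plane
`lvl ≥ 0` from a site of level `≤ L` to a site of level `≥ L` reaches, inside the strip
`0 ≤ lvl ≤ L`, some site of level exactly `L`. -/
private theorem exists_hit_level {ω : BondConfig (Site 2)} (hω : ω ⊆ (zdGraph 2).edgeSet) (L : ℕ)
    {x y : Site 2} (W : (openGraph ω).Walk x y) :
    (∀ v ∈ W.support, 0 ≤ v 0 + v 1) → x 0 + x 1 ≤ L → (L : ℤ) ≤ y 0 + y 1 →
      ∃ z : Site 2, z 0 + z 1 = L ∧ ω ∈ openConnIn (diagStrip L) x z := by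
  induction W with
  | @nil u =>
    intro hW hx hy
    have huS : u ∈ diagStrip L := ⟨hW u (by simp), hx⟩
    exact ⟨u, le_antisymm hx hy, huS, huS, SimpleGraph.Reachable.refl _⟩
  | @cons u v w hadj W' ih =>
    intro hW hx hy
    have huS : u ∈ diagStrip L := ⟨hW u (SimpleGraph.Walk.start_mem_support _), hx⟩
    by_cases hu : u 0 + u 1 = L
    · exact ⟨u, hu, huS, huS, SimpleGraph.Reachable.refl _⟩
    · have hv : v 0 + v 1 ≤ L := by
        rcases level_of_adj (adj_of_openGraph_adj hω hadj) with h1 | h1 <;> omega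
      obtain ⟨z, hz, hvS, hzS, hr⟩ :=
        ih (fun t ht => hW t (by rw [SimpleGraph.Walk.support_cons]; exact List.mem_cons_of_mem u ht))
          hv hy
      have hadj' : ((openGraph ω).induce (diagStrip L)).Adj ⟨u, huS⟩ ⟨v, hvS⟩ := hadj
      exact ⟨z, hz, huS, hzS, hadj'.reachable.trans hr⟩

/-- First-step decomposition: on lattice configurations, an open path inside the strip from a
site `a` of level `L ≥ 1` to the wall leaves `a` through a strip-neighbour `a − eᵢ`. -/
private theorem wallConn_first_step {ω : BondConfig (Site 2)} (hω : ω ⊆ (zdGraph 2).edgeSet)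
    {L : ℕ} (hL : 1 ≤ L) {a : Site 2} (ha : a 0 + a 1 = L) (h : ω ∈ wallConn L a) :
    ∃ i : Fin 2, ω ∈ wallConn L (a - Pi.single i 1) := by
  obtain ⟨w, hw, hconn⟩ := h
  obtain ⟨W, hW⟩ := exists_walk_of_openConnIn hconn
  cases W with
  | nil => exfalso; omega
  | @cons _ v _ hadj W' =>
    have hvS : v ∈ diagStrip L := hW v (by simp)
    have hv' : ω ∈ wallConn L v :=
      ⟨w, hw, openConnIn_of_walk W' fun t ht =>
        hW t (by rw [SimpleGraph.Walk.support_cons]; exact List.mem_cons_of_mem a ht)⟩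
    obtain ⟨i, hi | hi⟩ := (zdGraph_adj_iff a v).1 (adj_of_openGraph_adj hω hadj)
    · exfalso
      have h2 := hvS.2
      rw [hi] at h2
      simp only [Pi.add_apply] at h2
      have := level_single i
      omega
    · refine ⟨i, ?_⟩
      rw [← eq_sub_of_add_eq hi.symm]
      exact hv'

/-! ## Symmetries -/

/-- `wallConn` is an open crossing event of the strip, from `{b}` to the wall. -/
private theorem wallConn_eq (L : ℕ) (b : Site 2) :
    wallConn L b = openCrossing (diagStrip L) {b} {w | w 0 + w 1 = 0} := by
  ext ω
  simp only [wallConn, Set.mem_setOf_eq, mem_openCrossing_iff, Set.mem_singleton_iff,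
    exists_eq_left]

/-- A translation along the level lines preserves every level set. -/
private theorem image_shift_levelSet {v : Site 2} (hv : v 0 + v 1 = 0) (P : ℤ → Prop) :
    (· + v) '' {x : Site 2 | P (x 0 + x 1)} = {x | P (x 0 + x 1)} := by
  ext x
  constructor
  · rintro ⟨y, hy, rfl⟩
    simp only [Set.mem_setOf_eq, Pi.add_apply] at hy ⊢
    rwa [show y 0 + v 0 + (y 1 + v 1) = y 0 + y 1 by omega]
  · intro hx
    refine ⟨x - v, ?_, sub_add_cancel x v⟩
    simp only [Set.mem_setOf_eq, Pi.sub_apply] at hx ⊢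
    rwa [show x 0 - v 0 + (x 1 - v 1) = x 0 + x 1 by omega]

/-- A translation along the level lines preserves the strip. -/
private theorem image_shift_diagStrip {v : Site 2} (hv : v 0 + v 1 = 0) (L : ℕ) :
    (· + v) '' diagStrip L = diagStrip L :=
  image_shift_levelSet hv fun t => 0 ≤ t ∧ t ≤ (L : ℤ)

/-- A translation along the level lines preserves the wall. -/
private theorem image_shift_wall {v : Site 2} (hv : v 0 + v 1 = 0) :
    (· + v) '' {w : Site 2 | w 0 + w 1 = 0} = {w | w 0 + w 1 = 0} :=
  image_shift_levelSet hv fun t => t = 0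

/-- Sites of equal level have the same probability of being joined to the wall inside the strip
(translation invariance of `P_{1/2}` along the level lines). -/
private theorem real_wallConn_of_level_eq (L : ℕ) {b b' : Site 2} (h : b' 0 + b' 1 = b 0 + b 1) :
    (bondPercolation (zdGraph 2) half).real (wallConn L b') =
      (bondPercolation (zdGraph 2) half).real (wallConn L b) := by
  have hv : (b' - b) 0 + (b' - b) 1 = 0 := by simp only [Pi.sub_apply]; omega
  have key := real_openCrossing_shift half (b' - b) (diagStrip L) {b} {w : Site 2 | w 0 + w 1 = 0}
  rw [image_shift_diagStrip hv, image_shift_wall hv] at key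
  simp only [Set.image_singleton, add_sub_cancel] at key
  rw [wallConn_eq, wallConn_eq]
  exact key

/-- The level-reversing automorphism `x ↦ (L − x₁, −x₀)` of `ℤ²` (the anti-transposition
followed by the translation by `(L, 0)`). -/
private theorem exists_levelFlip (L : ℤ) :
    ∃ Φ : zdGraph 2 ≃g zdGraph 2, ∀ x : Site 2, Φ x 0 + Φ x 1 = L - (x 0 + x 1) := by
  refine ⟨(zdShiftIso (Pi.single 0 L)).comp (zdSignedPermIso (Equiv.swap 0 1) fun _ => -1),
    fun x => ?_⟩
  simp only [SimpleGraph.Iso.coe_comp, Function.comp_apply, zdShiftIso_apply,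
    zdSignedPermIso_apply, Pi.add_apply, Site.signedPerm_apply, Equiv.symm_swap,
    Equiv.swap_apply_left, Equiv.swap_apply_right, Units.val_neg, Units.val_one]
  simp
  ring

/-- A level-reversing automorphism carries level sets to level sets. -/
private theorem image_flip_levelSet {L : ℤ} (Φ : zdGraph 2 ≃g zdGraph 2)
    (hΦ : ∀ x : Site 2, Φ x 0 + Φ x 1 = L - (x 0 + x 1)) (P Q : ℤ → Prop)
    (hPQ : ∀ t, Q (L - t) ↔ P t) :
    Φ '' {x : Site 2 | P (x 0 + x 1)} = {y | Q (y 0 + y 1)} := by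
  ext y
  constructor
  · rintro ⟨x, hx, rfl⟩
    simp only [Set.mem_setOf_eq] at hx ⊢
    rw [hΦ]
    exact (hPQ _).2 hx
  · intro hy
    refine ⟨Φ.symm y, ?_, RelIso.apply_symm_apply Φ y⟩
    simp only [Set.mem_setOf_eq] at hy ⊢
    have h := hΦ (Φ.symm y)
    rw [RelIso.apply_symm_apply] at h
    rw [← hPQ, show L - (Φ.symm y 0 + Φ.symm y 1) = y 0 + y 1 by omega]
    exact hy

/-- A level-reversing automorphism preserves the strip. -/
private theorem image_flip_diagStrip {L : ℕ} (Φ : zdGraph 2 ≃g zdGraph 2)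
    (hΦ : ∀ x : Site 2, Φ x 0 + Φ x 1 = L - (x 0 + x 1)) :
    Φ '' diagStrip L = diagStrip L :=
  image_flip_levelSet Φ hΦ (fun t => 0 ≤ t ∧ t ≤ (L : ℤ)) (fun t => 0 ≤ t ∧ t ≤ (L : ℤ))
    fun t => by omega

/-- A level-reversing automorphism carries the free face `{lvl = L}` onto the wall. -/
private theorem image_flip_top {L : ℕ} (Φ : zdGraph 2 ≃g zdGraph 2)
    (hΦ : ∀ x : Site 2, Φ x 0 + Φ x 1 = L - (x 0 + x 1)) :
    Φ '' {z : Site 2 | z 0 + z 1 = L} = {w | w 0 + w 1 = 0} :=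
  image_flip_levelSet Φ hΦ (fun t => t = (L : ℤ)) (fun t => t = 0) fun t => by omega

/-! ## The stub -/

/-- Main lemma: for `1 ≤ L ≤ n` and `b` of level `L − 1`, `halfArm n ≤ 2 · P(wallConn L b)`. -/
private theorem halfArm_le_two_mul {L : ℕ} (hL : 1 ≤ L) {b : Site 2} (hb : b 0 + b 1 + 1 = L)
    {n : ℕ} (hn : L ≤ n) :
    halfArm n ≤ 2 * (bondPercolation (zdGraph 2) half).real (wallConn L b) := by
  unfold halfArm
  have hae : ∀ᵐ ω ∂(bondPercolation (zdGraph 2) half), ω ⊆ (zdGraph 2).edgeSet :=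
    ProbabilityTheory.setBernoulli_ae_subset
  obtain ⟨Φ, hΦ⟩ := exists_levelFlip (L : ℤ)
  have ha : Φ 0 0 + Φ 0 1 = L := by have := hΦ 0; simp only [Pi.zero_apply] at this; omega
  -- (1) monotonicity and truncation
  have h1 : (bondPercolation (zdGraph 2) half).real (halfArmEvent n) ≤
      (bondPercolation (zdGraph 2) half).real
        (openCrossing (diagStrip L) {(0 : Site 2)} {z : Site 2 | z 0 + z 1 = L}) := by
    refine ENNReal.toReal_mono (measure_ne_top _ _) (measure_mono_ae ?_)
    filter_upwards [hae] with ω hω hωn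
    obtain ⟨y, hy, hconn⟩ := hωn
    obtain ⟨W, hW⟩ := exists_walk_of_openConnIn hconn
    obtain ⟨z, hz, hz'⟩ := exists_hit_level hω L W (fun v hv => hW v hv)
      (by simp only [Pi.zero_apply]; omega) (by omega)
    exact ⟨0, rfl, z, hz, hz'⟩
  -- (2) symmetry
  have h2 : (bondPercolation (zdGraph 2) half).real
        (openCrossing (diagStrip L) {(0 : Site 2)} {z : Site 2 | z 0 + z 1 = L}) =
      (bondPercolation (zdGraph 2) half).real (wallConn L (Φ 0)) := by
    have key := bondPercolation_real_image Φ half (diagStrip L) {(0 : Site 2)}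
      {z : Site 2 | z 0 + z 1 = L}
    rw [image_flip_diagStrip Φ hΦ, image_flip_top Φ hΦ, Set.image_singleton] at key
    rw [← key, wallConn_eq]
  -- (3) first step and union bound
  have h3 : (bondPercolation (zdGraph 2) half).real (wallConn L (Φ 0)) ≤
      (bondPercolation (zdGraph 2) half).real (⋃ i : Fin 2, wallConn L (Φ 0 - Pi.single i 1)) := by
    refine ENNReal.toReal_mono (measure_ne_top _ _) (measure_mono_ae ?_)
    filter_upwards [hae] with ω hω hωa
    exact Set.mem_iUnion.2 (wallConn_first_step hω hL ha hωa)
  -- (4) translation along the level lines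
  have h4 : ∀ i : Fin 2, (bondPercolation (zdGraph 2) half).real (wallConn L (Φ 0 - Pi.single i 1)) =
      (bondPercolation (zdGraph 2) half).real (wallConn L b) := by
    intro i
    refine real_wallConn_of_level_eq L ?_
    simp only [Pi.sub_apply]
    have := level_single i
    omega
  calc (bondPercolation (zdGraph 2) half).real (halfArmEvent n)
      ≤ (bondPercolation (zdGraph 2) half).real
          (openCrossing (diagStrip L) {(0 : Site 2)} {z : Site 2 | z 0 + z 1 = L}) := h1
    _ = (bondPercolation (zdGraph 2) half).real (wallConn L (Φ 0)) := h2
    _ ≤ (bondPercolation (zdGraph 2) half).real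
          (⋃ i : Fin 2, wallConn L (Φ 0 - Pi.single i 1)) := h3
    _ ≤ ∑ i : Fin 2, (bondPercolation (zdGraph 2) half).real (wallConn L (Φ 0 - Pi.single i 1)) :=
        measureReal_iUnion_fintype_le _
    _ = ∑ _i : Fin 2, (bondPercolation (zdGraph 2) half).real (wallConn L b) :=
        Finset.sum_congr rfl fun i _ => h4 i
    _ = 2 * (bondPercolation (zdGraph 2) half).real (wallConn L b) := by
        rw [Fin.sum_univ_two, two_mul]

/-- **(P3) `stub_halfArm_le_strip` — lattice-symmetry glue.** For `L = 2m+1 ≤ n` and any site `b`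
of the level `2m`: `halfArm n ≤ 2 · P_{1/2}(wallConn L b)` (monotonicity in the depth, truncation
at the first passage of level `L`, the level-reversing automorphism of the strip, first-step
decomposition at the image of the origin and translation invariance along the level lines). -/
theorem stub_halfArm_le_strip : ∀ (m : ℕ) (b : Site 2), b 0 + b 1 = 2 * m → ∀ n : ℕ, 2 * m + 1 ≤ n →
    halfArm n ≤ 2 * (bondPercolation (zdGraph 2) half).real (wallConn (2 * m + 1) b) :=
  fun m _b hb _n hn => halfArm_le_two_mul (by omega) (by push_cast; omega) hn

end Summit.CriticalPhenomena.CardyFormulaZ2.Cruxes.EdgePrecompact.QkzStripBoundaryArm
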